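import Summits.Ventures.PercRepro.RankLevelSetMinorPairSkewSum
import Summits.Ventures.PercRepro.RankLevelSetBiIndepLR
import Summits.Ventures.PercRepro.RankLevelSetBiIndepContainSkew
import Summits.Ventures.PercRepro.RankLevelSetBiIndepContainSkewParallel

/-! # RankLevelSetBiIndepAvoidSkew — THE CUMULATIVE LADDER: (CX*)-cum ON THE MINORS ⟹ THE AVOID-`y` PROFILE IS
CUMULATIVELY SKEWED ⟹ (★★) AND THE AVOID-PROFILE MONOTONICITY (night-1 g30; dossier §42.15)

The avoid-`y` profile `b_k = yAvoidCount M y k = #{Z ∈ D_k : y ∉ Z}` (g26) splits into the FREE sets (`insert y Z`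
independent — exactly the bi-independent `k`-sets of the contraction `M ／ {y}`, `lowFreeAt_eq_biIndep_contract`) and
the ABSORBING sets (`lowAbsorbAt`, g28), and the absorbing sets fibre over the circuits `C ∋ y` into the contain-
`(C ∖ {y, x})` families of the minors `(M.contract {y}).delete {x}` one level down (g28: `ncard_lowAbsorbAt_eq_sum`,
`circuitLowCountAt_eq_biContainCount`). With the additive calculus of `RankLevelSetSkewConv`: the cumulative (CX*) of
those minors (parameter `(#E − 2) − 1`, shifted by one level: `#E − 1`) and the monotone form of `M ／ {y}` (from (★★)
of its minors, g24/g28) give **`yAvoidCount_skew : SkewConv.Skew (yAvoidCount M y) (#E − 1)`** — the avoid-`y` profile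
is skewed right about `(#E − 1)/2` CUMULATIVELY (`b_i ≤ b_j` for `i < j ≤ #E − 1 − i`) — under the hypothesis
«every minor `N` of `M` satisfies the cumulative (CX*) on every contain-set» (`MinorPairSkew N X ∅ (#E(N) − 2#X − 1)`).
Corollaries: **`biIndepPerElem_of_cum`** (the reflection (★★): `b_j ≤ b_{#E−1−j} = a_j`) and **`yAvoidCount_mono_of_cum`**
(g28's (AM): `b_k ≤ b_{k+1}` for `2(k+1) ≤ #E`, the consecutive monotonicity of the avoid profile, previously census
only). Nothing here asserts (CX*); every declaration has a docstring; imports: the cell's own modules and Mathlib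
only. Axioms: standard. -/

namespace PercRepro

open Set Matroid

variable {α : Type} (M : Matroid α) [M.Finite]

omit [M.Finite] in
/-- The free avoid-`y` sets are the bi-independent sets of the contraction `M ／ {y}` (for a non-loop `y`). -/
lemma lowFreeAt_eq_biIndep_contract {y : α} (hy : M.IsNonloop y) (k : ℕ) :
    lowFreeAt M y k = biIndep (M.contract {y}) k := by
  ext Z
  simp only [lowFreeAt, biIndep, Set.mem_setOf_eq, Matroid.contract_ground, hy.contractElem_indep_iff]
  constructor
  · rintro ⟨⟨hZE, hZk, -, hZc⟩, hyZ, hyZ'⟩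
    have hcompl : insert y ((M.E \ {y}) \ Z) = M.E \ Z := by
      ext x
      simp only [Set.mem_insert_iff, Set.mem_sdiff, Set.mem_singleton_iff]
      constructor
      · rintro (rfl | ⟨⟨hxE, -⟩, hxZ⟩)
        · exact ⟨hy.mem_ground, hyZ⟩
        · exact ⟨hxE, hxZ⟩
      · rintro ⟨hxE, hxZ⟩
        by_cases hxy : x = y
        · exact Or.inl hxy
        · exact Or.inr ⟨⟨hxE, hxy⟩, hxZ⟩
    refine ⟨fun x hx => ⟨hZE hx, fun hxy => hyZ (Set.mem_singleton_iff.mp hxy ▸ hx)⟩, hZk, ⟨hyZ, hyZ'⟩,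
      ⟨fun h => h.1.2 rfl, ?_⟩⟩
    rw [hcompl]
    exact hZc
  · rintro ⟨hZE, hZk, ⟨hyZ, hyZ'⟩, ⟨-, hZc⟩⟩
    have hZE' : Z ⊆ M.E := fun x hx => (hZE hx).1
    have hcompl : insert y ((M.E \ {y}) \ Z) = M.E \ Z := by
      ext x
      simp only [Set.mem_insert_iff, Set.mem_sdiff, Set.mem_singleton_iff]
      constructor
      · rintro (rfl | ⟨⟨hxE, -⟩, hxZ⟩)
        · exact ⟨hy.mem_ground, hyZ⟩
        · exact ⟨hxE, hxZ⟩
      · rintro ⟨hxE, hxZ⟩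
        by_cases hxy : x = y
        · exact Or.inl hxy
        · exact Or.inr ⟨⟨hxE, hxy⟩, hxZ⟩
    rw [hcompl] at hZc
    exact ⟨⟨hZE', hZk, hyZ'.subset (Set.subset_insert y Z), hZc⟩, hyZ, hyZ'⟩

/-- **The avoid-`y` profile is the free part plus the absorbing part.** -/
lemma yAvoidCount_eq_free_add_absorb (y : α) (k : ℕ) :
    yAvoidCount M y k = (lowFreeAt M y k).ncard + (lowAbsorbAt M y k).ncard := by
  unfold yAvoidCount
  have hfin : {Z ∈ biIndep M k | y ∉ Z}.Finite := (biIndep_finite M k).subset fun Z hZ => hZ.1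
  have hsplit : {Z ∈ biIndep M k | y ∉ Z} = lowFreeAt M y k ∪ lowAbsorbAt M y k := by
    ext Z
    simp only [lowFreeAt, lowAbsorbAt, Set.mem_setOf_eq, Set.mem_union]
    tauto
  have hdisj : Disjoint (lowFreeAt M y k) (lowAbsorbAt M y k) := by
    rw [Set.disjoint_left]
    rintro Z ⟨-, -, h1⟩ ⟨-, -, h2⟩
    exact h2 h1
  rw [hsplit, Set.ncard_union_eq hdisj (hfin.subset (by rw [hsplit]; exact Set.subset_union_left))
    (hfin.subset (by rw [hsplit]; exact Set.subset_union_right))]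

omit [M.Finite] in
/-- A circuit through a non-loop has a second element. -/
lemma exists_mem_circuit_ne {y : α} (hy : M.IsNonloop y) {C : Set α} (hC : M.IsCircuit C) (hyC : y ∈ C) :
    ∃ x ∈ C, x ≠ y := by
  by_contra hcon
  push Not at hcon
  have hCy : C = {y} := Set.eq_singleton_iff_unique_mem.mpr ⟨hyC, fun x hx => hcon x hx⟩
  exact hC.dep.not_indep (hCy ▸ hy.indep)

/-- The cumulative (CX*) on every minor of `M` (the hypothesis of the ladder, in the cumulative vocabulary). -/
def MinorsContainSkewCum : Prop :=
  ∀ N : Matroid α, Matroid.IsMinor N M → ∀ X ⊆ N.E, MinorPairSkew N X ∅ (N.E.ncard - 2 * X.ncard - 1)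

/-- Minors of `M` satisfy (CX*) when they satisfy its cumulative form. -/
lemma biContainSkew_minors_of_cum (h : MinorsContainSkewCum M) :
    ∀ N : Matroid α, Matroid.IsMinor N M → BiContainSkew N := by
  intro N hN
  haveI : N.Finite := ⟨M.ground_finite.subset hN.subset⟩
  exact biContainSkew_of_minorPairSkew N (h N hN)

/-- **The absorbing avoid-`y` profile is cumulatively skewed about `(#E − 1)/2`** under the cumulative (CX*) of the
minors `(M.contract {y}).delete {x}`: it is a sum over the circuits `C ∋ y` of contain profiles of those minors, shifted by one
level (parameter `(#E − 2) − 1 + 2`). -/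
theorem lowAbsorbAt_skew (h : MinorsContainSkewCum M) {y : α} (hy : M.IsNonloop y) :
    SkewConv.Skew (fun k => (lowAbsorbAt M y k).ncard) (M.E.ncard - 1) := by
  classical
  have hyE := hy.mem_ground
  have hyI : M.Indep {y} := hy.indep
  -- each circuit contributes a shifted contain profile of a minor with `#E − 2` elements
  have hcirc : ∀ C ∈ circuitsThroughAt M y,
      SkewConv.Skew (fun k => circuitLowCountAt M y C k) (M.E.ncard - 1) := by
    intro C hC
    rw [mem_circuitsThroughAt] at hC
    obtain ⟨x, hxC, hxy⟩ := exists_mem_circuit_ne M hy hC.1 hC.2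
    have hxE : x ∈ M.E := hC.1.subset_ground hxC
    set N := (M.contract {y}).delete {x} with hN
    have hNmin : Matroid.IsMinor N M := ⟨{y}, {x}, rfl⟩
    haveI : N.Finite := by rw [hN]; infer_instance
    have hx' : x ∈ M.E \ {y} := ⟨hxE, fun h => hxy (Set.mem_singleton_iff.mp h)⟩
    have hNcard : N.E.ncard = M.E.ncard - 2 := by
      rw [hN, minor_ground_eq', Set.ncard_sdiff_singleton_of_mem hx', Set.ncard_sdiff_singleton_of_mem hyE]
      omega
    have hXE : (C \ {y}) \ {x} ⊆ N.E := by
      rw [hN, minor_ground_eq']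
      intro z hz
      exact ⟨⟨hC.1.subset_ground hz.1.1, hz.1.2⟩, hz.2⟩
    -- the cumulative (CX*) of `N` at the contain-set, in the `α`-index: `Skew (α^X N) (#E(N) − 1)`
    have hskew := h N hNmin _ hXE
    have hXcard : ((C \ {y}) \ {x}).ncard ≤ N.E.ncard := Set.ncard_le_ncard hXE N.ground_finite
    -- translate to the contain profile and shift by one
    have hα : SkewConv.Skew (fun i => biContainCount N ((C \ {y}) \ {x}) i) (N.E.ncard - 1) := by
      intro i j hij hR
      show biContainCount N ((C \ {y}) \ {x}) i ≤ biContainCount N ((C \ {y}) \ {x}) j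
      rcases Nat.lt_or_ge i ((C \ {y}) \ {x}).ncard with hi | hi
      · rw [biContainCount_eq_zero_of_lt_ncard N hi]
        exact Nat.zero_le _
      · have hj : ((C \ {y}) \ {x}).ncard ≤ j := by omega
        rw [biContainCount_eq_minorPairCount N hXE hi, biContainCount_eq_minorPairCount N hXE hj]
        exact hskew _ _ (by omega) (by omega)
    have hshift := SkewConv.skew_shift hα 1
    refine SkewConv.skew_congr (SkewConv.skew_mono hshift (by omega)) fun k _ => ?_
    rcases k with _ | i
    · -- level `0`: no absorbing `0`-set through a circuit (`C ∖ {y}` is nonempty)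
      simp only [SkewConv.shiftSeq]
      rw [if_neg (by omega)]
      symm
      unfold circuitLowCountAt
      have hset : {P : Set α | P ⊆ M.E \ {y} ∧ P.ncard = 0 ∧ C \ {y} ⊆ P ∧ M.Indep P ∧
          M.Indep (insert y ((M.E \ {y}) \ P))} = ∅ := by
        apply Set.eq_empty_of_forall_notMem
        rintro P ⟨hPE, hP0, hCP, -, -⟩
        have hPe : P = ∅ := (Set.ncard_eq_zero (M.ground_finite.subset (hPE.trans Set.sdiff_subset))).mp hP0
        rw [hPe] at hCP
        exact hCP ⟨hxC, fun h => hxy (Set.mem_singleton_iff.mp h)⟩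
      rw [hset, Set.ncard_empty]
    · simp only [SkewConv.shiftSeq, Nat.succ_le_succ_iff, Nat.zero_le, if_true, Nat.add_sub_cancel]
      exact (circuitLowCountAt_eq_biContainCount M hC.1 hC.2 hxC hxy hyI i).symm
  have hsum := SkewConv.skew_sum (circuitsThroughAt M y) (fun C k => circuitLowCountAt M y C k) hcirc
  exact SkewConv.skew_congr hsum fun k _ => (ncard_lowAbsorbAt_eq_sum M hyE k).symm

/-- **The free avoid-`y` profile is cumulatively skewed about `(#E − 1)/2`**: it is the bi-independent profile of
`M ／ {y}` (`#E − 1` elements), whose monotone form follows from (★★) of its minors, hence from (CX*) of the minors. -/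
theorem lowFreeAt_skew (h : MinorsContainSkewCum M) {y : α} (hy : M.IsNonloop y) :
    SkewConv.Skew (fun k => (lowFreeAt M y k).ncard) (M.E.ncard - 1) := by
  have hmin : Matroid.IsMinor (M.contract {y}) M := ⟨{y}, ∅, (Matroid.delete_empty _).symm⟩
  have hmono : BiIndepMono (M.contract {y}) :=
    biIndepMono_of_perElem _ (biIndepPerElem_of_biContainSkew _
      fun N hN => biContainSkew_minors_of_cum M h N (Matroid.IsMinor.trans hN hmin))
  have hcard : (M.contract {y}).E.ncard = M.E.ncard - 1 := by
    rw [Matroid.contract_ground, Set.ncard_sdiff_singleton_of_mem hy.mem_ground]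
  have hD := minorPairSkew_empty_of_biIndepMono (M.contract {y}) hmono
  rw [hcard] at hD
  intro i j hij hR
  simp only [lowFreeAt_eq_biIndep_contract M hy]
  have e : ∀ k, (biIndep (M.contract {y}) k).ncard = minorPairCount (M.contract {y}) ∅ ∅ k := by
    intro k
    have := biContainCount_eq_minorPairCount (M.contract {y}) (Set.empty_subset _) (k := k) (by simp)
    rw [Set.ncard_empty, Nat.sub_zero] at this
    rw [← this, biContainCount_empty]
    rfl
  rw [e, e]
  exact hD i j hij hR

/-- **THE AVOID-`y` PROFILE IS CUMULATIVELY SKEWED ABOUT `(#E − 1)/2`** under the cumulative (CX*) of the minors: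
`b_i ≤ b_j` for `i < j`, `i + j ≤ #E − 1`. -/
theorem yAvoidCount_skew (h : MinorsContainSkewCum M) {y : α} (hy : M.IsNonloop y) :
    SkewConv.Skew (yAvoidCount M y) (M.E.ncard - 1) := by
  have := SkewConv.skew_add (lowFreeAt_skew M h hy) (lowAbsorbAt_skew M h hy)
  exact SkewConv.skew_congr this fun k _ => (yAvoidCount_eq_free_add_absorb M y k).symm

/-- **(AM), the consecutive monotonicity of the avoid profile**: `b_k ≤ b_{k+1}` for `2(k+1) ≤ #E`, under the
cumulative (CX*) of the minors (g28 §40.11: census only). -/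
theorem yAvoidCount_mono_of_cum (h : MinorsContainSkewCum M) {y : α} (hy : M.IsNonloop y) {k : ℕ}
    (hk : 2 * (k + 1) ≤ M.E.ncard) : yAvoidCount M y k ≤ yAvoidCount M y (k + 1) :=
  yAvoidCount_skew M h hy k (k + 1) (by omega) (by omega)

/-- **(★★) from the cumulative ladder**: the reflection form `b_j ≤ a_j` at every level, for every element. -/
theorem biIndepPerElem_of_cum (h : MinorsContainSkewCum M) : BiIndepPerElem M := by
  intro y hyE j hj
  by_cases hy : M.IsNonloop y
  · have hskew := yAvoidCount_skew M h hy
    have hj' : j + 1 ≤ M.E.ncard := by omega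
    have e1 : {Q ∈ biIndep M (j + 1) | y ∈ Q}.ncard = yThroughCount M y j := rfl
    have e2 : {Z ∈ biIndep M j | y ∉ Z}.ncard = yAvoidCount M y j := rfl
    rw [e1, e2, yThroughCount_eq_avoid_compl M hyE hj']
    exact hskew j (M.E.ncard - 1 - j) (by omega) (by omega)
  · -- a loop empties every level
    have hloop : ¬ M.Indep {y} := fun hI => hy (Matroid.indep_singleton.mp hI)
    have : {Z ∈ biIndep M j | y ∉ Z}.ncard = 0 := by
      rw [biIndep_eq_empty_of_loop M hyE hloop j]
      simp
    rw [this]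
    exact Nat.zero_le _

end PercRepro
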